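import Literature.AlgebraicGeometry.HodgeTheory.GeometricConiveauOfProductsSmallChowGroups
import Literature.AlgebraicGeometry.HodgeTheory.BettiHodgeConjectureCurveOrSurfaceTimesConiveauThreefold
import Literature.AlgebraicGeometry.HodgeTheory.BettiHodgeConjectureProductOfThreefoldsConiveauOrHodgeNumbers
import HarnessLib

/-!
# The coniveau profile of a variety whose `CH₀` is supported in dimension `≤ d` (Bloch–Srinivas below the middle, hard Lefschetz above), and ALL of Grothendieck's amended `GHC` for `T × T'`, `C × T`, `T × C`
# when the threefolds `T, T'` have `CH₀` supported on a CURVE (e.g. threefolds fibred in rationally connected surfaces over a curve) — no `CH₀ = ℤ`, no vanishing of `h^{1,0}` required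
# (Bloch–Srinivas 1983 Thm. 1; Voisin II Thm. 10.17, Cor. 10.21, Prop. 9.20; Voisin I Thm. 6.25, Thm. 11.38; Grothendieck 1969; Voisin 2025 Cor. 5.7)

Family `hodge`, lane `lit-hodgefound` (Track 2 foundations library; Layers A1/A4), layer `Literature/AlgebraicGeometry/HodgeTheory`.  THEOREMS ONLY (no definition, no named fact, no instance;
D-0026 net debt `0`).  Sequel of the seat's g33-#11/#14 (`generalHodgePropertyFor_tensor_of_forall_pieces`, the `ChowRankLEOneUpTo` profiles) for the tree's OTHER `CH₀`-hypothesis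
`Barriers.HodgeConjecture.HasChowZeroSupportedInDimLE X d`; `HC` of the products comes from the seat's g33-#3/#4 (`hodgeConjectureFor_tensor_threefolds_of_hasChowZeroSupportedInDimLE_two_one`,
`hodgeConjectureFor_curve_tensor_threefold_of_hasChowZeroSupportedInDimLE_two`, `hodgeConjectureFor_threefold_tensor_curve_of_hasChowZeroSupportedInDimLE_two`).

THE ARGUMENT.  For `X` of dimension `m` with `CH₀(X)` supported on a closed algebraic subset of dimension `≤ d`: `N¹ Hⁱ(X) = Hⁱ(X)` for `d < i` (Bloch–Srinivas, the tree's
`supportedClasses_eq_top_of_hasChowZeroSupportedInDimLE_of_lt`), and above the middle `N^{c+j} H^{k+2j} = H^{k+2j}` for `k + j = m` with `c = 1` if `k > d`, `c = 0` otherwise (hard-Lefschetz transport,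
`supportedClasses_eq_top_of_eq_top_of_add_eq_dim`).  No vanishing of `H¹` or `H^{2,0}` is needed or used: for two threefolds with `CH₀` on a curve the profile `(0, 0, 1, 1, 2, 2, 3)` already gives
`r ≤ ρ(i) + ρ(j)` on every OFF-diagonal lower-window cell of `T × T'` (the piece `H¹ ⊗ H¹ ⊂ H²` only meets the diagonal cell `(2, 1)`), and the diagonal cells are `HC(T × T')`.

WHAT IS PROVED (`0` sorrys; every statement a theorem).
* §1 `supportedClasses_profile_of_hasChowZeroSupportedInDimLE` (degrees `≤ m` and, by hard Lefschetz, `> m`).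
* §2 **`forall_generalHodgePropertyFor_tensor_threefolds_of_hasChowZeroSupportedInDimLE_one`** — ALL of `GHC(T × T')` for two smooth projective threefolds whose `CH₀` is supported on a curve;
  `forall_generalHodgePropertyFor_curve_tensor_threefold_of_hasChowZeroSupportedInDimLE_one` (+ mirror) — ALL of `GHC(C × T)`, `GHC(T × C)` for ANY curve `C` and such a threefold `T`.

THE PRINTS.  S. Bloch, V. Srinivas (1983) [BlochSrinivas1983] Thm. 1; C. Voisin (2003) [VoisinHodgeII2003] §10.2.2 Thm. 10.17, Cor. 10.18, Cor. 10.21, §9.2.4 Prop. 9.20; C. Voisin (2002) [VoisinHodgeI2002] §6.2.3 Thm. 6.25, §11.3.3 Thm. 11.38;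
A. Grothendieck (1969) [GrothendieckTopology1969] §1, pp. 300–301; C. Voisin (2025) [Voisin2025] §5.2 Cor. 5.7, §4.3; J. Murre (1994) [MurreTorino1994] §5.8.1.

THE OBJECTS (all the tree's).  `Barriers.HodgeConjecture.HasChowZeroSupportedInDimLE`, `supportedClasses`, `GeneralHodgePropertyFor`, `HodgeConjectureFor`; the tree's `supportedClasses_eq_top_of_hasChowZeroSupportedInDimLE_of_lt`,
`supportedClasses_eq_top_of_eq_top_of_add_eq_dim`, `supportedClasses_eq_top_of_le_of_add_eq_dim`, `supportedClasses_zero`, `supportedClasses_eq_top_of_dim_add_le`, `forall_generalHodgePropertyFor_iff_lower_window`,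
`generalHodgePropertyFor_two_mul_self_of_hodgeConjectureFor`, and the seat's `generalHodgePropertyFor_tensor_of_forall_pieces`, g33-#3/#4 `HC` theorems.

DEVIATIONS / SCOPE.  Complex orientations.  Only `d < dim` is interesting (for `d ≥ dim` the hypothesis is empty); the instances take `d = 1` on threefolds (by `HasChowZeroSupportedInDimLE.mono` this covers `CH₀`
supported on a point).  No claim for surfaces times such threefolds (the piece `H²(S) ⊗ H³(T)` is not forced).

## References
* [BlochSrinivas1983] S. Bloch, V. Srinivas, Amer. J. Math. 105 (1983) — Thm. 1.
* [VoisinHodgeII2003] C. Voisin, *Hodge Theory and Complex Algebraic Geometry II* — Thm. 10.17, Cor. 10.18, Cor. 10.21, Prop. 9.20.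
* [VoisinHodgeI2002] C. Voisin, *Hodge Theory and Complex Algebraic Geometry I* — §6.2.3 Thm. 6.25; §11.3.3 Thm. 11.38.
* [GrothendieckTopology1969] A. Grothendieck, Topology 8 (1969) — §1, pp. 300–301.
* [Voisin2025] C. Voisin (2025) — §5.2 Cor. 5.7; §4.3.
* [MurreTorino1994] J. Murre, LNM 1594 — §5.8.1.

## Provenance
Lane `lit-hodgefound` (summit `HodgeConjecture`, Track 2 foundations), seat `lit-hodgefound-p29` (literature-prover, generation 33, row g33-#15).
-/

noncomputable section

open CategoryTheory AlgebraicGeometry MonoidalCategory Module Finset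
open Literature.AlgebraicTopology.SingularHomology
open Literature.Geometry.Kaehler

namespace Literature.AlgebraicGeometry.HodgeTheory

open Literature.AlgebraicGeometry.Motives
open Literature.Barriers.HodgeConjecture (HasChowZeroSupportedInDimLE)

variable {n m : ℕ} {X C T T' : SchemeOver ℂ}

/-! ### §1 The coniveau profile of `CH₀` supported in dimension `≤ d` -/

/-- **The coniveau profile of an `m`-fold `X` whose `CH₀` is supported in dimension `≤ d`**, every degree `i ≤ 2m`: `N^{ρ(i)} Hⁱ(X) = Hⁱ(X)` with `ρ(i) = 0` for `i ≤ d`, `ρ(i) = 1` for `d < i ≤ m`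
(Bloch–Srinivas), and above the middle `ρ(i) = (i − m) + 1` if `2m − i > d`, `ρ(i) = i − m` otherwise (hard Lefschetz transport from degree `2m − i`). [cite: BlochSrinivas1983, Thm. 1]
[cite: VoisinHodgeII2003, §10.2.2 Thm. 10.17, Cor. 10.21 and §9.2.4 Prop. 9.20] [cite: VoisinHodgeI2002, §6.2.3 Thm. 6.25] [cite: Voisin2025, §5.2 Cor. 5.7 and §4.3] -/
theorem supportedClasses_profile_of_hasChowZeroSupportedInDimLE (hX : IsSmoothProjective m X) {d : ℕ} (hW : HasChowZeroSupportedInDimLE X d) (i : ℕ) (hi : i ≤ 2 * m) :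
    supportedClasses X i ((fun i : ℕ ↦ if i ≤ d then 0 else if i ≤ m then 1 else if d < 2 * m - i then i - m + 1 else i - m) i) = ⊤ := by
  dsimp only
  split_ifs with h1 h2 h3
  · exact supportedClasses_zero X i
  · exact supportedClasses_eq_top_of_hasChowZeroSupportedInDimLE_of_lt hX hW (by omega)
  · obtain ⟨j, rfl⟩ : ∃ j, i = m + j := ⟨i - m, by omega⟩
    have h := supportedClasses_eq_top_of_eq_top_of_add_eq_dim hX (k := m - j) (r := j) (c := 1) (by omega)
      (supportedClasses_eq_top_of_hasChowZeroSupportedInDimLE_of_lt hX hW (by omega))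
    rwa [show m - j + 2 * j = m + j by omega, show 1 + j = m + j - m + 1 by omega] at h
  · obtain ⟨j, rfl⟩ : ∃ j, i = m + j := ⟨i - m, by omega⟩
    have h := supportedClasses_eq_top_of_le_of_add_eq_dim hX (k := m - j) (r := j) (l := m + j) (s := m + j - m) (by omega) (by omega) (by omega)
    exact h

/-! ### §2 Threefolds whose `CH₀` is supported on a curve -/

/-- **ALL of Grothendieck's amended `GHC` for `T × T'`, two smooth projective THREEFOLDS whose `CH₀` is supported on a CURVE** — unconditionally.  With the profile `(0, 0, 1, 1, 2, 2, 3)` of such a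
threefold every OFF-diagonal lower-window cell `(k, r)` of the sixfold has `Nʳ Hᵏ(T × T') = Hᵏ(T × T')` (the piece `H¹ ⊗ H¹` only meets `(2, 1)`); the diagonal cells are `HC(T × T')` (g33-#3). [cite: GrothendieckTopology1969, §1, pp. 300–301]
[cite: BlochSrinivas1983, Thm. 1] [cite: VoisinHodgeII2003, §10.2.2 Thm. 10.17, Cor. 10.21 and §9.2.4 Prop. 9.20] [cite: VoisinHodgeI2002, §11.3.3 Thm. 11.38 and §6.2.3 Thm. 6.25] [cite: MurreTorino1994, §5.8.1] -/
theorem forall_generalHodgePropertyFor_tensor_threefolds_of_hasChowZeroSupportedInDimLE_one (hT : IsSmoothProjective 3 T) (hT' : IsSmoothProjective 3 T') (hW : HasChowZeroSupportedInDimLE T 1)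
    (hW' : HasChowZeroSupportedInDimLE T' 1) (i r : ℕ) : GeneralHodgePropertyFor (3 + 3) (T ⊗ T') i r := by
  refine (forall_generalHodgePropertyFor_iff_lower_window (hT.tensor_holds hT')).2 (fun k r hr h2 hk _ ↦ ?_) i r
  rcases (show 2 * r = k ∨ 2 * r < k by omega) with hdiag | hoff
  · subst hdiag
    exact generalHodgePropertyFor_two_mul_self_of_hodgeConjectureFor (hT.tensor_holds hT')
      (hodgeConjectureFor_tensor_threefolds_of_hasChowZeroSupportedInDimLE_two_one hT hT' (hW.mono (by norm_num)) hW') r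
  · refine generalHodgePropertyFor_tensor_of_forall_pieces hT hT' _ _ (supportedClasses_profile_of_hasChowZeroSupportedInDimLE hT hW)
      (supportedClasses_profile_of_hasChowZeroSupportedInDimLE hT' hW') fun a b hab ha hb ↦ ?_
    split_ifs <;> omega

/-- **ALL of `GHC(C × T)` for ANY smooth projective curve `C` and a smooth projective threefold `T` whose `CH₀` is supported on a curve** (curve profile `(0, 0, 1)`; diagonal cells by `HC(C × T)`, g33-#4).
[cite: GrothendieckTopology1969, §1, pp. 300–301] [cite: BlochSrinivas1983, Thm. 1] [cite: VoisinHodgeII2003, §10.2.2 Thm. 10.17 and Cor. 10.21] [cite: VoisinHodgeI2002, §11.3.3 Thm. 11.38] -/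
theorem forall_generalHodgePropertyFor_curve_tensor_threefold_of_hasChowZeroSupportedInDimLE_one (hC : IsSmoothProjective 1 C) (hT : IsSmoothProjective 3 T) (hW : HasChowZeroSupportedInDimLE T 1)
    (i r : ℕ) : GeneralHodgePropertyFor (1 + 3) (C ⊗ T) i r := by
  have tabC : ∀ i : ℕ, i ≤ 2 * 1 → supportedClasses C i ((fun i : ℕ ↦ if i = 2 then 1 else 0) i) = ⊤ := by
    intro i hi
    interval_cases i
    · exact supportedClasses_zero C 0
    · exact supportedClasses_zero C 1
    · exact supportedClasses_eq_top_of_dim_add_le hC (i := 2) (r := 1) (by norm_num)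
  refine (forall_generalHodgePropertyFor_iff_lower_window (hC.tensor_holds hT)).2 (fun k r hr h2 hk _ ↦ ?_) i r
  rcases (show 2 * r = k ∨ 2 * r < k by omega) with hdiag | hoff
  · subst hdiag
    exact generalHodgePropertyFor_two_mul_self_of_hodgeConjectureFor (hC.tensor_holds hT) (hodgeConjectureFor_curve_tensor_threefold_of_hasChowZeroSupportedInDimLE_two hC hT (hW.mono (by norm_num))) r
  · refine generalHodgePropertyFor_tensor_of_forall_pieces hC hT _ _ tabC (supportedClasses_profile_of_hasChowZeroSupportedInDimLE hT hW) fun a b hab ha hb ↦ ?_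
    split_ifs <;> omega

/-- Mirror: **ALL of `GHC(T × C)`**, `CH₀(T)` supported on a curve, `C` any curve. [cite: GrothendieckTopology1969, §1, pp. 300–301] [cite: BlochSrinivas1983, Thm. 1] [cite: VoisinHodgeI2002, §11.3.3 Thm. 11.38] -/
theorem forall_generalHodgePropertyFor_threefold_tensor_curve_of_hasChowZeroSupportedInDimLE_one (hT : IsSmoothProjective 3 T) (hC : IsSmoothProjective 1 C) (hW : HasChowZeroSupportedInDimLE T 1)
    (i r : ℕ) : GeneralHodgePropertyFor (3 + 1) (T ⊗ C) i r := by
  have tabC : ∀ i : ℕ, i ≤ 2 * 1 → supportedClasses C i ((fun i : ℕ ↦ if i = 2 then 1 else 0) i) = ⊤ := by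
    intro i hi
    interval_cases i
    · exact supportedClasses_zero C 0
    · exact supportedClasses_zero C 1
    · exact supportedClasses_eq_top_of_dim_add_le hC (i := 2) (r := 1) (by norm_num)
  refine (forall_generalHodgePropertyFor_iff_lower_window (hT.tensor_holds hC)).2 (fun k r hr h2 hk _ ↦ ?_) i r
  rcases (show 2 * r = k ∨ 2 * r < k by omega) with hdiag | hoff
  · subst hdiag
    exact generalHodgePropertyFor_two_mul_self_of_hodgeConjectureFor (hT.tensor_holds hC) (hodgeConjectureFor_threefold_tensor_curve_of_hasChowZeroSupportedInDimLE_two hT hC (hW.mono (by norm_num))) r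
  · refine generalHodgePropertyFor_tensor_of_forall_pieces hT hC _ _ (supportedClasses_profile_of_hasChowZeroSupportedInDimLE hT hW) tabC fun a b hab ha hb ↦ ?_
    split_ifs <;> omega

end Literature.AlgebraicGeometry.HodgeTheory

end
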